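import Mathlib
import HarnessLib
import Summits.HubbardSuperconductivity.HubbardSuperconductivity.Theorems.KLProgrammeKLRegimeKernelNormsLevelsDegreeCap

/-!
# Route `KLProgramme` — crux K3 ENGINE (stmt-HubbardSuperconductivity-20437 `KLRegimeEngineV17F2`), stub (b) v2, THE LEVELS PACKAGE (ℓ), read-out (I6)/(I7):
# «(ℓ)-RO5-TRACKS» — `KernelNormsLevels` at a level `j` from THREE TRACKS ONLY: prescriptions of exactly `1`, `3` and `5` legs
# (cell gate-hubbard-kl, seat p4 g20; located structural remainder «(ℓ)-READOUT-F» of k3c3-p2 g16, piece RO-5 = the per-level closer, p4 lineage)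

`KernelNormsLevels L M P Q β U μ K j` asks, for every even degree `2p ≥ 6` and EVERY partial prescription `Ωe` of leg sectors, the bound
`‖𝒱_j‖_{Ωe} ≤ CE^p·ε_j^{p−1}·2^{(3p−5)j}·(2^{−j})^{levelGainExp F}`, `F = levelCount Ωe`.  The right-hand side sees `F` only through
`levelGainExp F = min ((F−1)/2) 2 ∈ {0, 1, 2}` (value `0` for `F ≤ 2`, `1` for `F ∈ {3,4}`, `2` for `F ≥ 5`), and the left-hand side is ANTITONE in the
prescription (`klAnisoLegKernelNormAt_mono`: prescribing more legs drops tuples).  Hence three tracks suffice: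
* §1 `prescribedTuples_singlePrescription`, `sectorLegSum_eq_prescribed_single`, **`klAnisoLegKernelNormAt_le_of_forall_single`** — the UNPRESCRIBED norm (`F = 0`:
  a supremum of leg sums) is bounded by any common bound of the ONE-LEG prescriptions (each leg sum is a leg sum of the corresponding one-leg prescription);
* §2 `exists_coarser_levelCount_eq` — a prescription of `F ≥ c` legs has a coarsening prescribing exactly `c` of them; **`levels_clause_of_tracks`** — at a fixed
  degree, the clause for every `Ωe` from the clauses at level counts `1, 3, 5` (`F = 0` by §1; `F ∈ {1,2} ↦ 1`, `F ∈ {3,4} ↦ 3`, `F ≥ 5 ↦ 5` by coarsening, the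
  gain exponent being constant on these classes);
* §3 **`kernelNormsLevels_of_tracks`** (all `p ≥ 3`) and **`kernelNormsLevels_of_tracks_capped`** (`3 ≤ p ≤ D`, `card (HubbardFieldIdx L M) ≤ 2D+1`, with
  «(ℓ)-RO5-DEGREE-CAP» `kernelNormsLevels_of_capped`).
So the RO-5 closer feeds exactly the floor tracks `t = 0, 2, 4` (`F = t + 1`) of the F-chain, capped at one `D`.  Pure bookkeeping (finite suprema, filters,
a subset of prescribed cardinality); nothing about the model is asserted; nothing asserts (ℓ), any stub, K3 or superconductivity.
References: BGM 2006 §2.8 (2.76)–(2.77), Lemma 2.5 (2.98) [cite: BenfattoGiulianiMastropietro2006].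
-/

noncomputable section

namespace Summit.HubbardSuperconductivity.HubbardSuperconductivity.Theorems.KLRegimeSplit

set_option linter.dupNamespace false -- summit = problem name (single-conjunct summit), D-0017

open Classical
open Real Finset Literature.MathematicalPhysics.QuantumLattice Literature.Probability.LatticeModels
open Summit.HubbardSuperconductivity.HubbardSuperconductivity.Theorems.KLProgrammeLegKernels
open Summit.HubbardSuperconductivity.HubbardSuperconductivity.Theorems.KLRegimeWick

/-! ## §1 The unprescribed norm under the one-leg prescriptions -/

section Single

variable {N m : ℕ}

/-- The one-leg prescription `(p ↦ s)` (leg `p` carries the label `s`, every other leg is free — written out as the function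
`fun i => if i = p then some s else none` throughout, no definition introduced) has level `1`. [folklore] -/
theorem levelCount_singlePrescription (p : Fin m) (s : SectorLeg N) :
    levelCount (fun i : Fin m => if i = p then some s else (none : Option (SectorLeg N))) = 1 := by
  rw [levelCount, card_eq_one]
  refine ⟨p, ?_⟩
  ext i
  simp only [mem_filter, mem_univ, true_and, mem_singleton]
  split_ifs with h <;> simp [h]

/-- The tuples agreeing with the one-leg prescription `(p ↦ s)` are those of `A` with `Ω p = s`. [folklore] -/
theorem prescribedTuples_singlePrescription (A : Finset (Fin m → SectorLeg N)) (p : Fin m) (s : SectorLeg N) :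
    prescribedTuples A (fun i : Fin m => if i = p then some s else none) = A.filter fun Ω => Ω p = s := by
  ext Ω
  simp only [prescribedTuples, mem_filter, and_congr_right_iff]
  intro _
  constructor
  · intro h; exact h p s (by simp)
  · intro h i s' hs'
    by_cases hi : i = p
    · subst hi; simp at hs'; rw [← hs']; exact h
    · simp [hi] at hs'

/-- A prescription of level `0` prescribes nothing. [folklore] -/
theorem eq_none_of_levelCount_eq_zero {Ωe : Fin m → Option (SectorLeg N)} (h : levelCount Ωe = 0) (i : Fin m) : Ωe i = none := by
  rw [levelCount, card_eq_zero, filter_eq_empty_iff] at h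
  exact Option.not_isSome_iff_eq_none.1 (h (mem_univ i))

end Single

section SingleNorm

variable {L M : ℕ} [NeZero L]

/-- **The leg sum at `(p, s, x)` over all tuples is the same leg sum over the tuples of the one-leg prescription `(p ↦ s)`** (the filter `Ω p = s` is applied
twice). [cite: BenfattoGiulianiMastropietro2006, §2.8 (2.77)] -/
theorem sectorLegSum_eq_prescribed_single {N m : ℕ} (ε : ℝ) (A : Finset (Fin (m + 1) → SectorLeg N))
    (W : (Fin (m + 1) → SectorLeg N) → (Fin (m + 1) → SpaceTimeIdx L M) → ℂ) (p : Fin (m + 1)) (s : SectorLeg N) (x : SpaceTimeIdx L M) :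
    sectorLegSum ε A W p s x = sectorLegSum ε (prescribedTuples A (fun i : Fin (m + 1) => if i = p then some s else none)) W p s x := by
  rw [sectorLegSum_def, sectorLegSum_def, prescribedTuples_singlePrescription, filter_filter]
  simp only [and_self]

/-- **THE UNPRESCRIBED NORM UNDER THE ONE-LEG PRESCRIPTIONS**: if the levelled norm of every one-leg prescription of the `m+1` legs is `≤ C` (`0 ≤ C`), then
so is the levelled norm of every prescription of level `0` (the plain sectorised norm: a supremum of leg sums, each of which is a leg sum of the corresponding
one-leg prescription). [cite: BenfattoGiulianiMastropietro2006, §2.8 (2.76)-(2.77)] -/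
theorem klAnisoLegKernelNormAt_le_of_forall_single {β : ℝ} (U μ : ℝ) (K : TrigPolyC4v) (e₀ : ℝ) (n m : ℕ) {C : ℝ} (hC : 0 ≤ C)
    (h : ∀ (p : Fin (m + 1)) (s : SectorLeg (sectorCount n)),
      klAnisoLegKernelNormAt L M β U μ K e₀ n (m + 1) (fun i : Fin (m + 1) => if i = p then some s else none) ≤ C)
    {Ωe : Fin (m + 1) → Option (SectorLeg (sectorCount n))} (hΩe : levelCount Ωe = 0) :
    klAnisoLegKernelNormAt L M β U μ K e₀ n (m + 1) Ωe ≤ C := by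
  have hnone : Ωe = fun _ => none := funext (eq_none_of_levelCount_eq_zero hΩe)
  subst hnone
  rw [klAnisoLegKernelNormAt, hubbardSectorKernelNorm_def, prescribedTuples_none]
  refine sectorisedKernelNorm_le_of_forall_le hC fun p s x => ?_
  rw [sectorLegSum_eq_prescribed_single]
  refine (sectorLegSum_le_sectorisedKernelNorm _ _ _ p s x).trans ?_
  have := h p s
  rwa [klAnisoLegKernelNormAt, hubbardSectorKernelNorm_def] at this

end SingleNorm

/-! ## §2 Coarsening a prescription to a prescribed level count; the clause from three tracks -/

section Coarsen

variable {N m : ℕ}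

/-- **A prescription of `F ≥ c` legs has a coarsening prescribing exactly `c` of them** (keep `c` of the prescribed legs, free the rest); the coarsening is
refined by the original in the sense of `klAnisoLegKernelNormAt_mono`. [folklore] -/
theorem exists_coarser_levelCount_eq (Ωe : Fin m → Option (SectorLeg N)) {c : ℕ} (hc : c ≤ levelCount Ωe) :
    ∃ Ωc : Fin m → Option (SectorLeg N), levelCount Ωc = c ∧ ∀ i, ∀ s ∈ Ωc i, Ωe i = some s := by
  obtain ⟨S, hS, hcard⟩ := Finset.exists_subset_card_eq (s := univ.filter fun i => (Ωe i).isSome) hc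
  refine ⟨fun i => if i ∈ S then Ωe i else none, ?_, ?_⟩
  · rw [levelCount, ← hcard]
    congr 1
    ext i
    simp only [mem_filter, mem_univ, true_and]
    constructor
    · intro h
      by_contra hi
      rw [if_neg hi] at h
      exact Bool.false_ne_true h
    · intro hi
      rw [if_pos hi]
      exact (mem_filter.1 (hS hi)).2
  · intro i s hs
    by_cases hi : i ∈ S
    · simp only [hi, if_true] at hs; exact Option.mem_def.1 hs
    · simp [hi] at hs

end Coarsen

section Tracks

variable {L M : ℕ} [NeZero L]

/-- **THE LEVELLED CLAUSE AT A FIXED DEGREE FROM THE THREE TRACKS `F = 1, 3, 5`**: if, for the `m+1` legs at scale `n`, the levelled norm is bounded by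
`R e` (`e` = gain exponent) at every prescription of exactly `1` leg (`e = 0`), `3` legs (`e = 1`) and `5` legs (`e = 2`), with `0 ≤ R 0`, then at EVERY
prescription `Ωe` it is bounded by `R (levelGainExp (levelCount Ωe))`. [cite: BenfattoGiulianiMastropietro2006, Lemma 2.5 (2.98)] -/
theorem levels_clause_of_tracks {β : ℝ} (hβ : 0 ≤ β) (U μ : ℝ) (K : TrigPolyC4v) (e₀ : ℝ) (n : ℕ) {m : ℕ} (hm : 0 < m) {R : ℕ → ℝ} (hR0 : 0 ≤ R 0)
    (h1 : ∀ Ωe : Fin m → Option (SectorLeg (sectorCount n)), levelCount Ωe = 1 → klAnisoLegKernelNormAt L M β U μ K e₀ n m Ωe ≤ R 0)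
    (h3 : ∀ Ωe : Fin m → Option (SectorLeg (sectorCount n)), levelCount Ωe = 3 → klAnisoLegKernelNormAt L M β U μ K e₀ n m Ωe ≤ R 1)
    (h5 : ∀ Ωe : Fin m → Option (SectorLeg (sectorCount n)), levelCount Ωe = 5 → klAnisoLegKernelNormAt L M β U μ K e₀ n m Ωe ≤ R 2)
    (Ωe : Fin m → Option (SectorLeg (sectorCount n))) :
    klAnisoLegKernelNormAt L M β U μ K e₀ n m Ωe ≤ R (levelGainExp (levelCount Ωe)) := by
  obtain ⟨m, rfl⟩ : ∃ m', m = m' + 1 := ⟨m - 1, by omega⟩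
  by_cases hF0 : levelCount Ωe = 0
  · rw [hF0, levelGainExp_eq_zero_of_le_two (by norm_num)]
    exact klAnisoLegKernelNormAt_le_of_forall_single U μ K e₀ n m hR0 (fun p s => h1 _ (levelCount_singlePrescription p s)) hF0
  by_cases hF2 : levelCount Ωe ≤ 2
  · obtain ⟨Ωc, hc, hco⟩ := exists_coarser_levelCount_eq Ωe (c := 1) (by omega)
    rw [levelGainExp_eq_zero_of_le_two hF2]
    exact (klAnisoLegKernelNormAt_mono hβ U μ K e₀ n (m + 1) hco).trans (h1 Ωc hc)
  by_cases hF4 : levelCount Ωe ≤ 4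
  · obtain ⟨Ωc, hc, hco⟩ := exists_coarser_levelCount_eq Ωe (c := 3) (by omega)
    rw [levelGainExp_eq_one (by omega) hF4]
    exact (klAnisoLegKernelNormAt_mono hβ U μ K e₀ n (m + 1) hco).trans (h3 Ωc hc)
  · obtain ⟨Ωc, hc, hco⟩ := exists_coarser_levelCount_eq Ωe (c := 5) (by omega)
    rw [levelGainExp_eq_two (by omega)]
    exact (klAnisoLegKernelNormAt_mono hβ U μ K e₀ n (m + 1) hco).trans (h5 Ωc hc)

/-! ## §3 `KernelNormsLevels` from the three tracks (all degrees / capped degrees) -/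

/-- **`KernelNormsLevels` FROM THE THREE TRACKS** (all degrees): if `0 ≤ Q.CE`, `0 ≤ P.Klam` and, for every `p ≥ 3`, the clause
`‖𝒱_j‖_{Ωe} ≤ CE^p·ε_j^{p−1}·2^{(3p−5)j}·(2^{−j})^{e}` holds at every prescription of exactly `1` leg (`e = 0`), `3` legs (`e = 1`) and `5` legs (`e = 2`), then
`KernelNormsLevels L M P Q β U μ K j`. [cite: BenfattoGiulianiMastropietro2006, Lemma 2.5 (2.98)] -/
theorem kernelNormsLevels_of_tracks {β : ℝ} (hβ : 0 ≤ β) {U μ : ℝ} {K : TrigPolyC4v} {j : ℕ} {P : SplitConsts} {Q : EngConsts}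
    (hCE : 0 ≤ Q.CE) (hK : 0 ≤ P.Klam)
    (h : ∀ p : ℕ, 3 ≤ p → ∀ c e : ℕ, (c = 1 ∧ e = 0) ∨ (c = 3 ∧ e = 1) ∨ (c = 5 ∧ e = 2) →
      ∀ Ωe : Fin (2 * p) → Option (SectorLeg (sectorCount j)), levelCount Ωe = c →
        klAnisoLegKernelNormAt L M β U μ K klE0 j (2 * p) Ωe ≤
          Q.CE ^ p * (epsCoupling P U j) ^ (p - 1) * (2 : ℝ) ^ ((3 * (p : ℤ) - 5) * j) * (((2 : ℝ) ^ j)⁻¹) ^ e) :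
    KernelNormsLevels L M P Q β U μ K j := by
  intro p hp Ωe
  have hε : 0 ≤ epsCoupling P U j := by unfold epsCoupling; positivity
  exact levels_clause_of_tracks hβ U μ K klE0 j (m := 2 * p) (by omega)
    (R := fun e => Q.CE ^ p * (epsCoupling P U j) ^ (p - 1) * (2 : ℝ) ^ ((3 * (p : ℤ) - 5) * j) * (((2 : ℝ) ^ j)⁻¹) ^ e) (by positivity)
    (h p hp 1 0 (by omega)) (h p hp 3 1 (by omega)) (h p hp 5 2 (by omega)) Ωe

/-- **`KernelNormsLevels` FROM THE THREE TRACKS, CAPPED IN THE DEGREE** (the RO-5 closer's form): as `kernelNormsLevels_of_tracks` with the clauses asked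
only for `3 ≤ p ≤ D`, when `card (HubbardFieldIdx L M) ≤ 2·D + 1` («(ℓ)-RO5-DEGREE-CAP»). [cite: BenfattoGiulianiMastropietro2006, Lemma 2.5 (2.98)] -/
theorem kernelNormsLevels_of_tracks_capped {β : ℝ} (hβ : 0 ≤ β) {U μ : ℝ} {K : TrigPolyC4v} {j : ℕ} {P : SplitConsts} {Q : EngConsts}
    (hCE : 0 ≤ Q.CE) (hK : 0 ≤ P.Klam) {D : ℕ} (hD : Fintype.card (HubbardFieldIdx L M) ≤ 2 * D + 1)
    (h : ∀ p : ℕ, 3 ≤ p → p ≤ D → ∀ c e : ℕ, (c = 1 ∧ e = 0) ∨ (c = 3 ∧ e = 1) ∨ (c = 5 ∧ e = 2) →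
      ∀ Ωe : Fin (2 * p) → Option (SectorLeg (sectorCount j)), levelCount Ωe = c →
        klAnisoLegKernelNormAt L M β U μ K klE0 j (2 * p) Ωe ≤
          Q.CE ^ p * (epsCoupling P U j) ^ (p - 1) * (2 : ℝ) ^ ((3 * (p : ℤ) - 5) * j) * (((2 : ℝ) ^ j)⁻¹) ^ e) :
    KernelNormsLevels L M P Q β U μ K j := by
  refine kernelNormsLevels_of_capped hβ hCE hK hD fun p hp hpD Ωe => ?_
  have hε : 0 ≤ epsCoupling P U j := by unfold epsCoupling; positivity
  exact levels_clause_of_tracks hβ U μ K klE0 j (m := 2 * p) (by omega)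
    (R := fun e => Q.CE ^ p * (epsCoupling P U j) ^ (p - 1) * (2 : ℝ) ^ ((3 * (p : ℤ) - 5) * j) * (((2 : ℝ) ^ j)⁻¹) ^ e) (by positivity)
    (h p hp hpD 1 0 (by omega)) (h p hp hpD 3 1 (by omega)) (h p hp hpD 5 2 (by omega)) Ωe

end Tracks

end Summit.HubbardSuperconductivity.HubbardSuperconductivity.Theorems.KLRegimeSplit

end
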